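import Literature.MathematicalPhysics.QuantumFieldTheory.Balaban1983to89.B8Thm4ExistsAtGammaGRec
import Literature.MathematicalPhysics.QuantumFieldTheory.Balaban1983to89.B8Prop6DentedCubeMemberGammaRec

/-!
# `Balaban1983to89.B8Prop6DentedCubeMemberGammaGRec` — [Balaban1985RegularSpaces] PROPOSITION 6 (p. 99) ∕ [Balaban1985Variational] (152)–(153) AT THE DENTED RECORD CUBE
# MEMBER, MODULO THE THREE EXISTENCE BODIES, EDITION γ, CENTRED AVERAGING ([Balaban1987RG1] (0.4)) **WITH THE GAUGE-GROUP INVARIANT**: `U₀`, `u`, `w = v⁻¹u` `G`-VALUED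
# for an averaging-closed `G ≤ U(𝔸)` ([Balaban1985Averaging] p. 20; print's case of record `G = SU(N)`) — the `G`-form of the crown root
# `B8Prop6DentedCubeMemberGammaRec.prop6_exists_dentedMember_at_γ₃`

statement-level skeleton of published theorems with citation tags; proofs where landed; nothing here is a claim about the Yang–Mills mass gap

T. Bałaban, *Spaces of regular gauge field configurations on a lattice and gauge fixing conditions*, Commun. Math. Phys. **99** (1985) 75–102 `[Balaban1985RegularSpaces]`
("[6]"): Prop. 6 (1.135)–(1.136) p. 99, p. 99 (sentence after (1.133)), Thm 4 p. 88, Prop. 5 (1.107)–(1.108) p. 94, (1.58)–(1.59) p. 86, (1.31) p. 82, (1.29) p. 81, p. 76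
(«G = SU(N)»); T. Bałaban, *The variational problem and background fields in renormalization group method for lattice gauge theories*, CMP **102** (1985) 277–309
`[Balaban1985Variational]` ("[15]"): (148)–(153) p. 301; T. Bałaban, *Averaging operations for lattice gauge theories*, CMP **98** (1985) 17–51 `[Balaban1985Averaging]`
("[3]"): p. 20, (42)–(43) pp. 23–24; [I] = [Balaban1987RG1] (0.3)–(0.4) pp. 252–253; [B6] = [Balaban1984PropagatorsII] (2.3) p. 224.  STATUS: published, refereed.

CITATION HEADER (lean-in-tree rule).  Cell `pub-ymgap` (HUMAN RULING D-0062, Track A), «N05-REC» road (director-ym №254∕№255; LEAD PEN dag-n05-e), width seat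
`pub-ymgap-dag-n07-w3` g12 (the N05-REC → K-road JUNCTION; ⚑ LOCATED-SU-AT-JUNCTION, cell bus 2026-08-29).  WHY THIS FILE.  The third (last) head at which the record
chain drops the gauge group to `U(𝔸)`: the crown ROOT `B8Prop6DentedCubeMemberGammaRec.prop6_exists_dentedMember_at_γ₃` (dag-n05-e g38).  THIS FILE is the SAME theorem
over the `G`-form of the Thm-4 driver (`B8Thm4ExistsAtGammaGRec.thm4Exists_concrete_at_γ_mem`): statement byte for byte dag-n05-e's with
`(G : Subgroup 𝔸ˣ) (hG : G ≤ unitaryUnits 𝔸) (hGavg : AvgClosedZ d L G)` added, `U₀` `G`-valued, the two Proposition-5 socket bodies read with `v x ∈ G` ∕ `u₁ x ∈ G`, and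
the conclusion's membership clauses `u x ∈ G`, `(v⁻¹u) x ∈ G` (`v = localGaugeZ …` is `G`-valued for `G`-valued `U₀` by dag-n05-d's `B8Prop6OfThm4Rec.localGaugeZ_mem` under
`AvgClosedZ d L G` — [3] (42)–(43): the averages of `G`-valued fields are `G`-valued); the «assumptions of Theorem 4» package `thm4_hypotheses_one_cutFixed_dented_γ` and the
dented geometry BY NAME; proof = dag-n05-e's, four tokens changed.  Engine model: the `G`-chain `B8Prop6CubeMember…G` (dag-n05-e g33, pure cube).  Consumer: dag-n05-e's
crown tail (`…GaugedRealGammaRec` → `…ScalarGammaOfNamedFactsRec.gaugedBoundB8DZ_dentedMember_of_cov159`) in its `G := SU(N)` edition (`SU(N)` averaging-closed for the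
record, `B7Prop2SpecialUnitaryRec.avgClosedZ_specialUnitary`, `N ≤ 12`), read by the junction's `RecordCrownSUBody` (this seat's `Thm/BalabanUVNodesN07DatumCrownOfRecordCrown`).
Kind «kernel-checked proof», ONE theorem; no `def`, no `instance`, no `notation`, no existing module modified.  `--kind proof --supports stmt-QuantumFields-20541` (K0⁷-keyed,
COUNT-NEUTRAL).

HONEST SCOPE: Prop. 6's conclusion at the dented record member MODULO the three displayed existence bodies (Prop. 5 base∕step = Sect. E in `G`-form; the β-shaped (1.59)
body) — exactly as the unitary root; nothing of Bałaban's analysis re-proved; the `G`-form Sect.-E sockets (print p. 76: for `G = SU(N)` the exponent `λ` is trace-free) are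
NOT supplied here; `HThm4Rec` UNDISCHARGED (caveat (C-S3-1)); N05 ∕ N07 NOT discharged; COUNT of record unmoved · K numerically unchanged; one finite `𝕋⁴` programme at fixed
`ε`, Bałaban AS PRINTED; nothing continuum ∕ ℝ⁴ ∕ OS ∕ mass-gap ∕ Clay.  No `sorry`, no `def`.

[cite: Balaban1985RegularSpaces, Prop. 6 (1.135)–(1.136) p.99, Thm 4 p.88, Prop. 5 (1.107)–(1.108) p.94, (1.58)–(1.59) p.86, (1.31) p.82, (1.29) p.81, p.76; Balaban1985Variational, (148)–(153) p.301; Balaban1985Averaging, p.20, (42)–(43) pp.23–24; Balaban1987RG1, (0.3)–(0.4) pp.252–253]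
-/

noncomputable section

namespace Literature.MathematicalPhysics.QuantumFieldTheory.Balaban1983to89.B8Prop6DentedCubeMemberGammaGRec

open B7Prop1Explicit B7Prop2Explicit B7Prop1Local
open B7Eq92Concrete (mgauge mgauge_apply mgauge_one_left)
open B7Prop2Explicit (c2' unitaryUnits unitaryUnits_le_U1)
open B7Prop2Rec (AvgClosedZ C0Z avgClosedZ_unitaryUnits)
open BlockAveragingZd (avgIterZ ctrShift)
open B7SectEFLinearisationRec (linCovIterZ)
open B8Ineq130Rec (tlo thi tlo_le_thi)
open B8Ineq132 (covDerivFwd InAk BondTouches condAt_anti)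
open B8Ineq132Rec (pdevOn_lt_of_inAk_box)
open B8Ineq133Rec (cutFixedZ ineq133)
open B8Eq115GaugeFixingRec (localGaugeZ)
open B8Eq119TwistedAxialRec (InAxZ Restr129Z inAxZ_one_iff inAxOneZ_of_tower)
open B8Eq184Proof (gaugeExp cfgExp)
open B8Lemma1NonAbelian (mulCfg)
open B8Lemma1NonAbelianRecLoops (halfVec)
open B8Eq140Level (SideTouches)
open B8Eq146AExpansion (iEta)
open B8Eq155JBound (Jcur wsup)
open B8ScaledSupNorm (bondNorm msup)
open B8Eq138LandauZd (logCfg)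
open B8Eq138LandauZdRec (IsLandau138WZ)
open B8Eq131Cubes (tLo tHi ctr ctr_mem two_crad_le tLo_le_tHi)
open B8Eq131CubesRec (sq_le_tilde)
open B8Eq131CubesAdmissibleRec (cubeFamZ)
open B8Prop6OfThm4 (one_inAk agree135)
open B8Prop6OfThm4Rec (localGaugeZ_mem)
open B8Prop6CubeMemberRec (tlo_tlo thi_thi)
open B8Ineq133CubeMemberGammaRec (thm4_hypotheses_one_cutFixedZ_γ)
open B8Thm4ExistsAtGammaGRec (thm4Exists_concrete_at_γ_mem)
open B9SupplySockB9P3ZdBeta (CrossB)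
open B8DentedCubeMemberZdRec (lamST_of_lt lamST_top_apply inBox_sq_of_mem_lamST hΩ_sq lamBPT_hbox_pred lamBPT_hclass bdryLayer_dented)
open B8Prop6DentedCubeMemberGammaRec (inAxZ_lamST_cutFixedZ thm4_hypotheses_one_cutFixed_dented_γ)
open Node00 (CubeB8DZ)

export B7Prop1Explicit (Site)

variable {d : ℕ}

/-! ## §1 PROPOSITION 6 ∕ (152)–(153) at the dented RECORD member, background `1`, modulo the three existence bodies — edition γ, `G`-valued -/

section Prop6

variable {𝔸 : Type} [CStarAlgebra 𝔸] [Nontrivial 𝔸]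

/-- ★★★ (`G`-FORM of dag-n05-e's `B8Prop6DentedCubeMemberGammaRec.prop6_exists_dentedMember_at_γ₃`.) **PROPOSITION 6 (p. 99) ∕ [15] (152)–(153) AT THE DENTED RECORD CUBE
MEMBER, MODULO THE THREE EXISTENCE BODIES AT THE FLAT DATUM `(1, U₀″)`, EDITION γ, CENTRED AVERAGING, WITH THE GAUGE-GROUP INVARIANT**: for an averaging-closed subgroup
`G ≤ U(𝔸)` ([3] p. 20, (42)–(43); [6] p. 76 «G = SU(N)»), ONE threshold `c₁ > 0`; for every dented datum at which the three bodies hold (Prop. 5 base∕step `G`-valued), every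
`G`-VALUED `U₀ ∈ 𝔄_k({Ω_j}, α₀)` in the regime of (1.130) with `L³α₀ + 6dL²Mα₀ ≤ c₁`: THERE IS a `G`-valued `u`, `= 1` off `□₀`, with (1.29)∕(152) «ū_j = 1 on Λ′_j» for the
DENTED cells, such that `U₁ := U₀″^{u⁻¹}` satisfies the Landau gauge of record (1.38)∕(153) and (1.62) (`U₁ = e^{iηA}`, `A` Hermitian, `|A_b| ≤ 5dLB₀(L³α₀ + 6dL²Mα₀)(Lʲη)⁻¹`), and
(1.135): `w := v⁻¹u` `G`-VALUED (`v` = the local axial-type gauge `localGaugeZ`, `G`-valued by `localGaugeZ_mem`), `U₀^{w⁻¹} = U₁` on `□̃`.  Every other binder byte for byte the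
unitary root's.
[cite: Balaban1985RegularSpaces, Prop. 6 (1.135)–(1.136) p.99, p.99 (sentence after (1.133)), Thm 4 p.88, Prop. 5 (1.107)–(1.108) p.94, (1.58)–(1.59) p.86, (1.31) p.82, p.76; Balaban1985Variational, (148)–(153) p.301; Balaban1985Averaging, p.20, (42)–(43) pp.23–24; Balaban1987RG1, (0.3)–(0.4) pp.252–253; Balaban1984PropagatorsII, (2.3) p.224] -/
theorem prop6_exists_dentedMember_at_γ₃_mem (hd2 : 2 ≤ d) {L s : ℕ} (hLs : L = 2 * s + 1) (hs : 1 ≤ s)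
    (G : Subgroup 𝔸ˣ) (hG : G ≤ unitaryUnits 𝔸) (hGavg : AvgClosedZ d L G) {B₀ B₀' Bbd : ℝ} (hB₀ : 0 < B₀) (hB₀' : 0 < B₀')
    (hB : 2 ≤ 5 * (d : ℝ) * L * B₀) (hBbd : 0 ≤ Bbd) (hBd : 4 * Bbd ≤ ((d : ℝ) * L - 1) * B₀) :
    ∃ c₁ : ℝ, 0 < c₁ ∧ ∀ (η : ℝ), 0 < η → ∀ {K : ℕ} {Ω : ℕ → Set (Site d)} (c : CubeB8DZ d L K Ω),
      ∀ (U₀ : Site d → Fin d → 𝔸ˣ), (∀ x κ, U₀ x κ ∈ G) → ∀ (α₀ : ℝ), 0 < α₀ →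
      C0Z d * (α₀ * (L : ℝ) ^ 2) ≤ 1 / 3 → 2 * (α₀ * (L : ℝ) ^ 2) ≤ c2' d L →
      InAk L c.k η α₀ Ω U₀ →
      11 * (d : ℝ) ^ 2 * (L : ℝ) ^ 2 * α₀ + ((c.M : ℝ) + 4 * c.ρ) * d * (L : ℝ) ^ 2 * α₀ ≤ 1 / 6 →
      (L : ℝ) ^ 3 * α₀ + 6 * d * (L : ℝ) ^ 2 * c.M * α₀ ≤ c₁ →
      ((∃ (v : Site d → 𝔸ˣ) (lam : Site d → 𝔸), (∀ x, v x ∈ G) ∧ (∀ x, x ∉ c.sq 0 → v x = 1) ∧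
        (∀ j, j ≤ 1 → ∀ b ∈ {b : Site d × Fin d | SideTouches (c.sq j) b.1 b.2}, (v b.1 : 𝔸) = ((gaugeExp lam b.1 : 𝔸ˣ) : 𝔸) ∧
        (v (b.1 + e b.2) : 𝔸) = ((gaugeExp lam (b.1 + e b.2) : 𝔸ˣ) : 𝔸)) ∧
        (∀ j, j ≤ 1 → ∀ b ∈ {b : Site d × Fin d | SideTouches (c.sq j) b.1 b.2},
        ‖lam b.1‖ ≤ (8 * B₀' * (5 * (d : ℝ) * L * B₀) * (((L : ℝ) ^ 3 * α₀) + (6 * d * (L : ℝ) ^ 2 * c.M * α₀))) ∧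
          ((L : ℝ) ^ j * η) * ‖covDerivFwd η (1 : Site d → Fin d →
          𝔸ˣ) b.2 lam b.1‖ ≤ (8 * B₀' * (5 * (d : ℝ) * L * B₀) * (((L : ℝ) ^ 3 * α₀) + (6 * d * (L : ℝ) ^ 2 * c.M * α₀)))) ∧
        IsLandau138WZ L 1 η (c.sq 0) (c.lamST 1) (1 : Site d → Fin d → 𝔸ˣ) (mgauge (1 : Site d → Fin d →
          𝔸ˣ) v⁻¹ (cutFixedZ L (tLo c.a c.ρ) (tHi c.a c.M c.ρ) U₀ c.k (ctr c.a c.M))) ∧ Restr129Z L 1 (c.lamST 1) (1 : Site d → Fin d → 𝔸ˣ) ((1 : Site d →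
          𝔸ˣ) * v))) →
      ((∀ m, 1 ≤ m → m < c.k → ∀ (u₁ : Site d → 𝔸ˣ) (U₁ : Site d → Fin d → 𝔸ˣ) (A : Site d → Fin d → 𝔸),
        (∀ x, u₁ x ∈ G) → (∀ x, x ∉ c.sq 0 → u₁ x = 1) → mgauge (1 : Site d → Fin d →
          𝔸ˣ) u₁ U₁ = (cutFixedZ L (tLo c.a c.ρ) (tHi c.a c.M c.ρ) U₀ c.k (ctr c.a c.M)) → Restr129Z L m (c.lamST m) (1 : Site d → Fin d → 𝔸ˣ) u₁ →
        IsLandau138WZ L m η (c.sq 0) (c.lamST m) (1 : Site d → Fin d → 𝔸ˣ) U₁ →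
        (∀ j, j ≤ m → ∀ b ∈ {b : Site d × Fin d | SideTouches (c.sq j) b.1 b.2},
        U₁ b.1 b.2 = cfgExp η A b.1 b.2 ∧ IsSelfAdjoint (A b.1 b.2) ∧
          ‖A b.1 b.2‖ ≤ (5 * (d : ℝ) * L * B₀ * (((L : ℝ) ^ 3 * α₀) + (6 * d * (L : ℝ) ^ 2 * c.M * α₀))) * ((L : ℝ) ^ j * η)⁻¹) →
        ∃ (v : Site d → 𝔸ˣ) (lam : Site d → 𝔸), (∀ x, v x ∈ G) ∧ (∀ x, x ∉ c.sq 0 → v x = 1) ∧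
        (∀ j, j ≤ m + 1 →
          ∀ b ∈ {b : Site d × Fin d | SideTouches (c.sq j) b.1 b.2}, (v b.1 : 𝔸) = ((gaugeExp lam b.1 : 𝔸ˣ) : 𝔸) ∧
        (v (b.1 + e b.2) : 𝔸) = ((gaugeExp lam (b.1 + e b.2) : 𝔸ˣ) : 𝔸)) ∧
        (∀ j, j ≤ m + 1 → ∀ b ∈ {b : Site d × Fin d | SideTouches (c.sq j) b.1 b.2},
        ‖lam b.1‖ ≤ (8 * B₀' * (5 * (d : ℝ) * L * B₀) * (((L : ℝ) ^ 3 * α₀) + (6 * d * (L : ℝ) ^ 2 * c.M * α₀))) ∧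
          ((L : ℝ) ^ j * η) * ‖covDerivFwd η (1 : Site d → Fin d →
          𝔸ˣ) b.2 lam b.1‖ ≤ (8 * B₀' * (5 * (d : ℝ) * L * B₀) * (((L : ℝ) ^ 3 * α₀) + (6 * d * (L : ℝ) ^ 2 * c.M * α₀)))) ∧
        IsLandau138WZ L (m + 1) η (c.sq 0) (c.lamST (m + 1)) (1 : Site d → Fin d → 𝔸ˣ) (mgauge (1 : Site d → Fin d →
          𝔸ˣ) v⁻¹ U₁) ∧ Restr129Z L (m + 1) (c.lamST (m + 1)) (1 : Site d → Fin d → 𝔸ˣ) (u₁ * v))) →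
      ((∀ m, 1 ≤ m → m ≤ c.k → ∀ (u : Site d → 𝔸ˣ) (W : Site d → Fin d → 𝔸ˣ) (A' : Site d → Fin d → 𝔸),
        (∀ x, u x ∈ unitaryUnits 𝔸) → (∀ x, x ∉ c.sq 0 → u x = 1) →
          mgauge (1 : Site d → Fin d → 𝔸ˣ) u W = (cutFixedZ L (tLo c.a c.ρ) (tHi c.a c.M c.ρ) U₀ c.k (ctr c.a c.M)) →
          Restr129Z L m (c.lamST m) (1 : Site d → Fin d → 𝔸ˣ) u →
          IsLandau138WZ L m η (c.sq 0) (c.lamST m) (1 : Site d → Fin d → 𝔸ˣ) W →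
        (∀ y τ, IsSelfAdjoint (A' y τ)) →
        (∀ j, j ≤ m → ∀ y τ, SideTouches (c.sq j) y τ →
        W y τ = cfgExp η A' y τ ∧
          ‖A' y τ‖ ≤ (2 * (L * (5 * (d : ℝ) * L * B₀ * (((L : ℝ) ^ 3 * α₀) + (6 * d * (L : ℝ) ^ 2 * c.M * α₀)))) + 8 * (8 * B₀' * (5 * (d : ℝ) * L * B₀) * (((L : ℝ) ^ 3 * α₀) + (6 * d * (L : ℝ) ^ 2 * c.M * α₀)))) * ((L : ℝ) ^ j * η)⁻¹) →
        (∀ y τ, (∀ j, j ≤ m → ¬ SideTouches (c.sq j) y τ) → A' y τ = 0) →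
        msup L m η (-(1 : ℝ)) (fun j (b : Site d × Fin d) => SideTouches (c.sq j) b.1 b.2) (fun b => A' b.1 b.2)
        ≤ B₀ * (bondNorm L m η (-(3 : ℝ)) c.sq (fun x μ => Jcur η (1 : Site d → Fin d → 𝔸ˣ) A' μ x)
        + wsup 1 (fun p : {p : ℕ × (Site d × Fin d) // p.1 ≤ m ∧ (p.2 ∈ c.lamBPT m p.1 ∨ (p.1 = 0 ∧ CrossB (c.sq 0) p.2))} =>
        linCovIterZ L (1 : Site d → Fin d → 𝔸ˣ) (iEta η A') p.1.1 p.1.2.1 p.1.2.2))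
        + Bbd * msup L m η (-(1 : ℝ)) (fun j (b : Site d × Fin d) => j = 0 ∧ SideTouches (c.sq 0) b.1 b.2 ∧
            ¬ BondTouches (c.sq 0) b.1 b.2) (fun b => A' b.1 b.2) ∧
        msup L m η (-(2 : ℝ)) (fun j (t : Fin d × Fin d × Site d) => SideTouches (c.sq j) t.2.2 t.2.1)
        (fun t => covDerivFwd η (1 : Site d → Fin d → 𝔸ˣ) t.1 (fun z => A' z t.2.1) t.2.2)
        ≤ B₀ * (bondNorm L m η (-(3 : ℝ)) c.sq (fun x μ => Jcur η (1 : Site d → Fin d → 𝔸ˣ) A' μ x)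
        + wsup 1 (fun p : {p : ℕ × (Site d × Fin d) // p.1 ≤ m ∧ (p.2 ∈ c.lamBPT m p.1 ∨ (p.1 = 0 ∧ CrossB (c.sq 0) p.2))} =>
        linCovIterZ L (1 : Site d → Fin d → 𝔸ˣ) (iEta η A') p.1.1 p.1.2.1 p.1.2.2))
        + Bbd * msup L m η (-(1 : ℝ)) (fun j (b : Site d × Fin d) => j = 0 ∧ SideTouches (c.sq 0) b.1 b.2 ∧
            ¬ BondTouches (c.sq 0) b.1 b.2) (fun b => A' b.1 b.2))) →
      ∃ u : Site d → 𝔸ˣ, (∀ x, u x ∈ G) ∧ (∀ x, x ∉ c.sq 0 → u x = 1) ∧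
        Restr129Z L c.k c.lamS (1 : Site d → Fin d → 𝔸ˣ) u ∧
        IsLandau138WZ L c.k η (c.sq 0) c.lamS (1 : Site d → Fin d → 𝔸ˣ)
          (gaugeAct u⁻¹ (cutFixedZ L (tLo c.a c.ρ) (tHi c.a c.M c.ρ) U₀ c.k (ctr c.a c.M))) ∧
        (∀ j, j ≤ c.k → ∀ b ∈ {b : Site d × Fin d | SideTouches (c.sq j) b.1 b.2},
          gaugeAct u⁻¹ (cutFixedZ L (tLo c.a c.ρ) (tHi c.a c.M c.ρ) U₀ c.k (ctr c.a c.M)) b.1 b.2 =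
              cfgExp η (logCfg η (gaugeAct u⁻¹ (cutFixedZ L (tLo c.a c.ρ) (tHi c.a c.M c.ρ) U₀ c.k (ctr c.a c.M)))) b.1 b.2 ∧
            IsSelfAdjoint (logCfg η (gaugeAct u⁻¹ (cutFixedZ L (tLo c.a c.ρ) (tHi c.a c.M c.ρ) U₀ c.k (ctr c.a c.M))) b.1 b.2) ∧
            ‖logCfg η (gaugeAct u⁻¹ (cutFixedZ L (tLo c.a c.ρ) (tHi c.a c.M c.ρ) U₀ c.k (ctr c.a c.M))) b.1 b.2‖ ≤
              (5 * (d : ℝ) * L * B₀ * ((L : ℝ) ^ 3 * α₀ + 6 * d * (L : ℝ) ^ 2 * c.M * α₀)) * ((L : ℝ) ^ j * η)⁻¹) ∧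
        (∀ x, ((localGaugeZ L (tLo c.a c.ρ) (tHi c.a c.M c.ρ) U₀ c.k (ctr c.a c.M))⁻¹ * u) x ∈ G) ∧
        AgreeOn (B8Ineq130Rec.tlo L (tLo c.a c.ρ) c.k) (B8Ineq130Rec.thi L (tHi c.a c.M c.ρ) c.k)
          (gaugeAct ((localGaugeZ L (tLo c.a c.ρ) (tHi c.a c.M c.ρ) U₀ c.k (ctr c.a c.M))⁻¹ * u)⁻¹ U₀)
          (gaugeAct u⁻¹ (cutFixedZ L (tLo c.a c.ρ) (tHi c.a c.M c.ρ) U₀ c.k (ctr c.a c.M))) := by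
  have hL1 : 1 ≤ L := by omega
  have hL : 2 ≤ L := by omega
  have hLo : Odd L := ⟨s, hLs⟩
  have hd1 : 1 ≤ d := le_trans (by norm_num) hd2
  obtain ⟨c₁, hc₁, H⟩ := thm4Exists_concrete_at_γ_mem (𝔸 := 𝔸) hd2 hLs hs G hG hB₀ hB₀' hB hBbd hBd
  refine ⟨c₁, hc₁, ?_⟩
  intro η hη K Ω c U₀ hU₀G α₀ hα hα3 hα2 hA hsmall hc P5base₁ P5step₁ H59Dβ₁
  have hU₀ : ∀ x κ, U₀ x κ ∈ unitaryUnits 𝔸 := fun x κ => hG (hU₀G x κ)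
  have hk : 1 ≤ c.k := c.one_le_k
  have hρ : 1 ≤ c.ρ := hL1.trans c.L_le_ρ
  have hM1 : 1 ≤ c.M := hρ.trans c.ρ_le_M
  have hLpos : (0 : ℝ) < L := by exact_mod_cast lt_of_lt_of_le (by norm_num) hL
  have hdpos : (0 : ℝ) < d := by exact_mod_cast hd1
  have hMpos : (0 : ℝ) < c.M := by exact_mod_cast hM1
  have hα₀' : 0 < (L : ℝ) ^ 3 * α₀ := by positivity
  have hα₁' : 0 < 6 * (d : ℝ) * (L : ℝ) ^ 2 * c.M * α₀ := by positivity
  obtain ⟨hmem, h33, h34, hAx, h135, h66⟩ :=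
    thm4_hypotheses_one_cutFixed_dented_γ hLs hs hd1 c U₀ hU₀ hα hα3 hα2 hη hA hsmall
  have hone : ∀ x κ, (1 : Site d → Fin d → 𝔸ˣ) x κ ∈ unitaryUnits 𝔸 := fun _ _ => (unitaryUnits 𝔸).one_mem
  obtain ⟨u, hu, huS, h129, hLan, h162⟩ := H η hη c.k c.sq (hΩ_sq c hLo) c.lamST c.lamBPT (lamBPT_hbox_pred c hLs) (lamBPT_hclass c hLs)
    (bdryLayer_dented c hLs hs) _ _ hα₀' hα₁' hc 1 _ hone hmem h33 h34 hAx h135 h66 P5base₁ P5step₁ H59Dβ₁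
  simp only [mgauge_one_left] at hLan h162
  have htop : c.lamST c.k = c.lamS := funext (lamST_top_apply c)
  rw [htop] at h129 hLan
  have hΩ' : ∃ l, l ≤ c.k ∧ c.k ≤ l + 1 ∧ ∀ x, InBox (B8Ineq130Rec.tlo L (tLo c.a c.ρ) c.k) (B8Ineq130Rec.thi L (tHi c.a c.M c.ρ) c.k) x → x ∈ Ω l :=
    ⟨c.k - 1, Nat.sub_le _ _, by omega, fun x hx => c.tcube_sub hx⟩
  have hvG : ∀ x, localGaugeZ L (tLo c.a c.ρ) (tHi c.a c.M c.ρ) U₀ c.k (ctr c.a c.M) x ∈ G :=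
    localGaugeZ_mem hLs hL hGavg c.k U₀ hU₀G hα hα3 hα2 (tLo_le_tHi hM1)
      (pdevOn_lt_of_inAk_box hL1 hα hA hΩ') (ctr c.a c.M)
  exact ⟨u, hu, huS, h129, hLan hk, h162, fun x => G.mul_mem (G.inv_mem (hvG x)) (hu x),
    agree135 _ _ U₀ _ u⟩

#print axioms prop6_exists_dentedMember_at_γ₃_mem

end Prop6

end Literature.MathematicalPhysics.QuantumFieldTheory.Balaban1983to89.B8Prop6DentedCubeMemberGammaGRec

end
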